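import Summits.SmoothPoincare4.SmoothPoincare4.Theses.DottedCircleRasmussen

/-!
# Route DottedCircleRasmussen — support item `DcrRungGlue` (stmt-SmoothPoincare4-16120)

The k = 1 rung implies the target: a one-handle slice gap witnessed with ONE dotted circle
(`DcrGapOne`) is a one-handle slice gap (`DcrGap`), by instantiating `k := 1`.  The body of
`DcrGapOne` is literally the body of `DcrGap` with `k` replaced by `1`, so the proof is pure logic.
-/

-- the prescribed namespace `Summit.<P>.<Sub>.…` duplicates `SmoothPoincare4` (P = Sub)
set_option linter.dupNamespace false

namespace Summit.SmoothPoincare4.SmoothPoincare4.Theorems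

open Summit.SmoothPoincare4.SmoothPoincare4.Theses.DottedCircleRasmussen

/-- **Glue for route DottedCircleRasmussen** (item `DcrRungGlue`, stmt-SmoothPoincare4-16120):
`DcrGapOne → DcrGap` — the gap with one dotted circle is a gap (take `k := 1`; the model circle,
the homotopy-sphere witness and the no-disc clause are carried over verbatim). -/
theorem DcrRungGlue_proof :
    Summit.SmoothPoincare4.SmoothPoincare4.Theses.DottedCircleRasmussen.DcrRungGlue := by
  unfold DcrRungGlue
  rintro ⟨K, hK, hM, hno⟩
  exact ⟨1, K, hK, hM, hno⟩

end Summit.SmoothPoincare4.SmoothPoincare4.Theorems
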